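import Mathlib
import Summits.ValiantsHypothesis.ValiantsHypothesis.Theorems.NewtonUnitEquationsTwoProductsConeChart
import Summits.ValiantsHypothesis.ValiantsHypothesis.Theorems.NewtonUnitEquationsTwoProductsExposure
import Summits.ValiantsHypothesis.ValiantsHypothesis.Theorems.NewtonUnitEquationsTwoProductsFormalLogLinearisationDefs
import Summits.ValiantsHypothesis.ValiantsHypothesis.Theorems.NewtonUnitEquationsTwoProductsFormalLogLinearisationChartTools

/-!
# Crux `TwoProducts` (stmt-ValiantsHypothesis-5906), line `formal-log-linearisation`: STUB 2 `stub_chartNormalisation`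

The registered line `Cruxes/TwoProducts/Lines/formal-log-linearisation.lean` (NOT the item's skeleton of record)
reduces the crux `TwoProducts` to a count of weight-visible points of a signed sum of formal logarithms.  Its
STUB 2 (`stub_chartNormalisation`, "M, provable now") is the chart normalisation: for a cancelling top-assignment
`(a, b)` of a `t`-sparse instance `(f, g)` there is a normalised instance `(u, v)` (zero constant terms, `≤ t − 1`
monomials a side) whose VISIBLE set is at least as large as the HIDDEN set of `(a, b)`.  This file proves it
VERBATIM over the objects of `Theorems/NewtonUnitEquationsTwoProductsFormalLogLinearisationDefs.lean` (= the line's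
objects, same names and bodies).

## Proof (no `SL₂(ℤ)`: any integer chart with nonzero determinant adapted to the tails will do)

If the hidden set is empty take `u = v = 0`.  Otherwise some real weight `ξ₀` makes every `a_j` (`b_j`) the strict
top of `supp f_j` (`supp g_j`).  (1) ROUNDING: the landed `TwoProducts.Exposure.exists_int_form_of_real_form`
(applied to the single finite set of shifted tails `M − a_j + p`, `M = Σ a + Σ b`, with unique minimiser `M` for
`−ξ₀`) gives an INTEGER form `w` with `w·a_j < w·p` for every tail `p ≠ a_j` of `f_j` (same for `g`).  (2) CHART:
`L e = (w·e, K·(w·e) + e_i)` with `K = M_i` and `i` chosen so that `det = ±w_{1−i} ≠ 0` is additive, injective and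
ADAPTED (`L a_j ≤ L p` componentwise on `supp f_j`), which is exactly the input of the landed corner-log chart
engine `TwoProducts.ConeChart.cc_*` (file `…TwoProductsConeChart.lean`): the local factors
`u'_j = Σ_{p ∈ supp f_j} (coeff p f_j / coeff a_j f_j)·X^{Ψ_{a_j} p}` have constant term `1` and `≤ t` monomials
(`cc_local_coeff_zero`, `cc_local_card`), and under `Cancelling` one has
`coeff (Ψ_M e) (∏ u' − ∏ v') = coeff e (∏ f − ∏ g) / ∏ coeff a_j f_j` above the corner (`cc_prod_local_coeff`,
`cc_prod_local_support`).  The tails are `u_j := u'_j − 1`.  (3) WEIGHTS over `ℝ`: `ξ' := L^{−T} ξ` (explicit `2×2`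
inverse, `exists_transport_weight` of `…FormalLogLinearisationChartTools.lean`, where Steps 1–3 live) satisfies `wt ξ' (Ψ_N x) = wt ξ x − wt ξ N` (`wt_psi`), so a weight realising
`(a, b)` becomes a VALID weight for `(u, v)` and a strict `ξ`-top `e` of `supp (∏ f − ∏ g)` becomes the strict
`ξ'`-top `Ψ_M e` of `supp (∏ (1+u) − ∏ (1+v))`; `Ψ_M` is injective above the corner, so `hidden ↪ visible`.

Honest framing: a bookkeeping/transport stub of a registered non-record line; the line's open engine
`stub_logSumEngine` and the crux `TwoProducts` are untouched and OPEN; nothing here bears on `VP ≠ VNP`.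
-/

set_option linter.dupNamespace false

noncomputable section

open scoped BigOperators
open MvPolynomial

namespace Summit.ValiantsHypothesis.ValiantsHypothesis.Theorems.NewtonUnitEquations.TwoProducts.FormalLogLinearisation

variable {m : ℕ}

/-! ## STUB 2 -/

/-- **STUB 2 of line `formal-log-linearisation` (`stub_chartNormalisation`), verbatim**: for a cancelling
top-assignment `(a,b)` of a `t`-sparse instance there is a normalised instance `(u,v)` (zero constant terms,
`≤ t − 1` monomials each) whose visible set is at least as large as the hidden set of `(a,b)`. [folklore] -/
theorem stub_chartNormalisation :
    ∀ (m t : ℕ) (f g : Fin m → MvPolynomial (Fin 2) ℂ), (∀ j, (f j).support.card ≤ t) →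
      (∀ j, (g j).support.card ≤ t) →
        ∀ a b : Fin m → Expo, Cancelling f g a b →
          ∃ u v : Fin m → MvPolynomial (Fin 2) ℂ,
            (∀ j, coeff 0 (u j) = 0 ∧ (u j).support.card ≤ t - 1) ∧
            (∀ j, coeff 0 (v j) = 0 ∧ (v j).support.card ≤ t - 1) ∧
              (hidden f g a b).ncard ≤ (visible u v).ncard := by
  classical
  intro m t f g hf hg a b hcan
  by_cases hne : (hidden f g a b).Nonempty
  swap
  · refine ⟨fun _ => 0, fun _ => 0, fun j => ⟨by simp, by simp⟩, fun j => ⟨by simp, by simp⟩, ?_⟩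
    rw [Set.not_nonempty_iff_eq_empty.mp hne, Set.ncard_empty]
    exact Nat.zero_le _
  obtain ⟨l₀, ξ₀, hfa, hgb, -⟩ := hne
  have ha : ∀ j, a j ∈ (f j).support := fun j => Finset.mem_coe.mp (hfa j).1
  have hb : ∀ j, b j ∈ (g j).support := fun j => Finset.mem_coe.mp (hgb j).1
  -- Steps 1–2: an adapted integer chart
  obtain ⟨w, hwf, hwg⟩ := exists_int_form_of_tops f g a b ξ₀ hfa hgb
  obtain ⟨r₁, r₂, hdet, hAf, hAg⟩ := exists_adapted_rows f g a b w hwf hwg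
  obtain ⟨L, hL0, hL1⟩ : ∃ L : Expo →+ (Fin 2 → ℤ),
      (∀ e, L e 0 = r₁ 0 * ((e 0 : ℕ) : ℤ) + r₁ 1 * ((e 1 : ℕ) : ℤ)) ∧
        ∀ e, L e 1 = r₂ 0 * ((e 0 : ℕ) : ℤ) + r₂ 1 * ((e 1 : ℕ) : ℤ) :=
    ⟨AddMonoidHom.mk' (fun (e : Expo) (i : Fin 2) =>
        (![r₁, r₂] i) 0 * ((e 0 : ℕ) : ℤ) + (![r₁, r₂] i) 1 * ((e 1 : ℕ) : ℤ))
      (fun p q => funext fun i => by simp only [Finsupp.coe_add, Pi.add_apply, Nat.cast_add]; ring),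
      fun _ => rfl, fun _ => rfl⟩
  have hLinj : Function.Injective L := fun p q h =>
    TwoProducts.ConeChart.cc_chart_injective r₁ r₂ hdet p q (by rw [← hL0, ← hL0, h]) (by rw [← hL1, ← hL1, h])
  have hAf' : ∀ j, ∀ p ∈ (f j).support, L (a j) ≤ L p := fun j p hp => by
    rw [Pi.le_def, Fin.forall_fin_two, hL0, hL0, hL1, hL1]; exact hAf j p hp
  have hAg' : ∀ j, ∀ p ∈ (g j).support, L (b j) ≤ L p := fun j p hp => by
    rw [Pi.le_def, Fin.forall_fin_two, hL0, hL0, hL1, hL1]; exact hAg j p hp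
  -- the local instance (constant terms `1`) and its tails
  obtain ⟨u', hu'⟩ : ∃ u' : Fin m → MvPolynomial (Fin 2) ℂ, ∀ j, u' j = ∑ p ∈ (f j).support,
      monomial (Finsupp.equivFunOnFinite.symm fun i => (L p i - L (a j) i).toNat)
        (coeff p (f j) / coeff (a j) (f j)) := ⟨_, fun _ => rfl⟩
  obtain ⟨v', hv'⟩ : ∃ v' : Fin m → MvPolynomial (Fin 2) ℂ, ∀ j, v' j = ∑ p ∈ (g j).support,
      monomial (Finsupp.equivFunOnFinite.symm fun i => (L p i - L (b j) i).toNat)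
        (coeff p (g j) / coeff (b j) (g j)) := ⟨_, fun _ => rfl⟩
  have hu0 : ∀ j, coeff 0 (u' j) = 1 := fun j =>
    (hu' j) ▸ TwoProducts.ConeChart.cc_local_coeff_zero L hLinj (f j) (a j) (ha j) (hAf' j)
  have hv0 : ∀ j, coeff 0 (v' j) = 1 := fun j =>
    (hv' j) ▸ TwoProducts.ConeChart.cc_local_coeff_zero L hLinj (g j) (b j) (hb j) (hAg' j)
  refine ⟨fun j => u' j - 1, fun j => v' j - 1,
    fun j => ⟨by rw [coeff_sub, coeff_zero_one, hu0 j, sub_self],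
      card_support_sub_one_le (u' j) t ((hu' j) ▸ (TwoProducts.ConeChart.cc_local_card L (f j) (a j)).trans (hf j))
        (hu0 j)⟩,
    fun j => ⟨by rw [coeff_sub, coeff_zero_one, hv0 j, sub_self],
      card_support_sub_one_le (v' j) t ((hv' j) ▸ (TwoProducts.ConeChart.cc_local_card L (g j) (b j)).trans (hg j))
        (hv0 j)⟩, ?_⟩
  -- the normalised difference is `∏ u' − ∏ v'`
  have htail : tailDiff (fun j => u' j - 1) (fun j => v' j - 1) = ∏ j, u' j - ∏ j, v' j := by
    simp only [tailDiff, add_sub_cancel]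
  set F := ∏ j, f j - ∏ j, g j with hF
  set D := ∏ j, u' j - ∏ j, v' j with hD
  obtain ⟨hMM, hcc⟩ := hcan
  have hc : ∏ j, coeff (a j) (f j) ≠ 0 := Finset.prod_ne_zero_iff.mpr fun j _ => mem_support_iff.mp (ha j)
  have hcoefD : ∀ e, L (∑ j, a j) ≤ L e →
      coeff (Finsupp.equivFunOnFinite.symm fun i => (L e i - L (∑ j, a j) i).toNat) D =
        coeff e F / ∏ j, coeff (a j) (f j) := by
    intro e he
    rw [hD, hF, coeff_sub, coeff_sub, sub_div, TwoProducts.ConeChart.cc_prod_local_coeff L hLinj f a hAf' u' hu' _ rfl e he,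
      TwoProducts.ConeChart.cc_prod_local_coeff L hLinj g b hAg' v' hv' _ hMM.symm e he, hcc]
  have hchart : ∀ d ∈ D.support, ∃ e, L (∑ j, a j) ≤ L e ∧
      d = Finsupp.equivFunOnFinite.symm fun i => (L e i - L (∑ j, a j) i).toNat := by
    intro d hd
    rcases Finset.mem_union.mp (support_sub _ _ _ hd) with h | h
    · exact TwoProducts.ConeChart.cc_prod_local_support L f a hAf' u' hu' _ rfl d h
    · exact TwoProducts.ConeChart.cc_prod_local_support L g b hAg' v' hv' _ hMM.symm d h
  have hFle : ∀ e ∈ F.support, L (∑ j, a j) ≤ L e := by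
    intro e he
    rcases Finset.mem_union.mp (support_sub _ _ _ he) with h | h
    · exact TwoProducts.ConeChart.cc_le_chart_of_mem_support L f a hAf' _ rfl e h
    · exact TwoProducts.ConeChart.cc_le_chart_of_mem_support L g b hAg' _ hMM.symm e h
  -- `Ψ` charts the hidden set injectively into the visible set
  show (hidden f g a b).ncard ≤ (visible (fun j => u' j - 1) (fun j => v' j - 1)).ncard
  unfold visible
  rw [htail]
  refine Set.ncard_le_ncard_of_injOn
    (fun e => Finsupp.equivFunOnFinite.symm fun i => (L e i - L (∑ j, a j) i).toNat) ?_ ?_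
    ((D.support.finite_toSet).subset fun d hd => ?_)
  · -- a hidden point with its realising weight `ξ` goes to a visible point with weight `ξ' = L^{-T} ξ`
    intro e he
    obtain ⟨ξ, hfa', hgb', heF, hemax⟩ := he
    have heF' : e ∈ F.support := Finset.mem_coe.mp heF
    obtain ⟨ξ', hξ'⟩ := exists_transport_weight r₁ r₂ hdet ξ
    refine ⟨ξ', ⟨fun j d hd => ?_, fun j d hd => ?_⟩, ?_, fun d hd hne => ?_⟩
    · -- tails of `u_j` have negative transported weight
      have hd' : d ∈ (u' j).support := by
        have h := support_sub _ _ _ hd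
        rcases Finset.mem_union.mp h with h | h
        · exact h
        · exfalso
          rw [support_one, Finset.mem_singleton] at h
          subst h
          rw [mem_support_iff, coeff_sub, coeff_zero_one, hu0 j, sub_self] at hd
          exact hd rfl
      have hd0 : d ≠ 0 := by
        rintro rfl
        rw [mem_support_iff, coeff_sub, coeff_zero_one, hu0 j, sub_self] at hd
        exact hd rfl
      rw [hu' j] at hd'
      obtain ⟨p, hp, rfl⟩ := exists_of_mem_support_local L (f j) (a j) _ hd'
      have hpa : p ≠ a j := by
        rintro rfl
        exact hd0 (TwoProducts.ConeChart.cc_psi_self L (a j))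
      rw [wt_psi L r₁ r₂ hL0 hL1 ξ ξ' hξ' (a j) p (hAf' j p hp)]
      have hlt := (hfa' j).2 p (Finset.mem_coe.mpr hp) hpa
      linarith
    · have hd' : d ∈ (v' j).support := by
        have h := support_sub _ _ _ hd
        rcases Finset.mem_union.mp h with h | h
        · exact h
        · exfalso
          rw [support_one, Finset.mem_singleton] at h
          subst h
          rw [mem_support_iff, coeff_sub, coeff_zero_one, hv0 j, sub_self] at hd
          exact hd rfl
      have hd0 : d ≠ 0 := by
        rintro rfl
        rw [mem_support_iff, coeff_sub, coeff_zero_one, hv0 j, sub_self] at hd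
        exact hd rfl
      rw [hv' j] at hd'
      obtain ⟨p, hp, rfl⟩ := exists_of_mem_support_local L (g j) (b j) _ hd'
      have hpb : p ≠ b j := by
        rintro rfl
        exact hd0 (TwoProducts.ConeChart.cc_psi_self L (b j))
      rw [wt_psi L r₁ r₂ hL0 hL1 ξ ξ' hξ' (b j) p (hAg' j p hp)]
      have hlt := (hgb' j).2 p (Finset.mem_coe.mpr hp) hpb
      linarith
    · -- `Ψ e` lies in `supp D`
      refine Finset.mem_coe.mpr ?_
      rw [mem_support_iff, hcoefD e (hFle e heF')]
      exact div_ne_zero (mem_support_iff.mp heF') hc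
    · -- every other point of `supp D` has smaller transported weight
      have hdD : d ∈ D.support := Finset.mem_coe.mp hd
      obtain ⟨e₁, he₁, rfl⟩ := hchart d hdD
      have he₁F : e₁ ∈ F.support := by
        rw [mem_support_iff, hcoefD e₁ he₁] at hdD
        exact mem_support_iff.mpr fun h0 => hdD (by rw [h0, zero_div])
      have hlt := hemax e₁ (Finset.mem_coe.mpr he₁F) fun h => hne (by rw [h])
      rw [wt_psi L r₁ r₂ hL0 hL1 ξ ξ' hξ' _ e₁ he₁, wt_psi L r₁ r₂ hL0 hL1 ξ ξ' hξ' _ e (hFle e heF')]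
      linarith
  · -- `Ψ` is injective on the hidden set
    intro e₁ h₁ e₂ h₂ hΨ
    obtain ⟨-, -, -, h₁F, -⟩ := h₁
    obtain ⟨-, -, -, h₂F, -⟩ := h₂
    exact hLinj (TwoProducts.ConeChart.cc_psi_inj L _ e₁ e₂ (hFle e₁ (Finset.mem_coe.mp h₁F))
      (hFle e₂ (Finset.mem_coe.mp h₂F)) hΨ)
  · -- finiteness: visible points lie in `supp D`
    obtain ⟨_, -, hd, -⟩ := hd
    exact hd

end Summit.ValiantsHypothesis.ValiantsHypothesis.Theorems.NewtonUnitEquations.TwoProducts.FormalLogLinearisation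

end
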